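import Literature.MathematicalPhysics.QuantumFieldTheory.Balaban1983to89.B9Eq3126KFloorFlat

/-!
# `Balaban1983to89.B9Eq3126KFloorDiagonal` — T. Bałaban, *Propagators for lattice gauge theories in a background field*, Commun. Math. Phys. **99** (1985)
# 389–434 [Balaban1985BackgroundPropagators] (3.126) p. 420, Thm 3.11 p. 416, with [Balaban1985Variational] (46) p. 285 («B₀ … uniform»): **ON PRINT's
# DIAGONAL `ηL = 1`, `c₀L^d = c₁` THE FLAT ONE-STEP LETTERS `(Q(1)G₁(1)Q(1)†)⁻¹` AND `H₁(1)` OF THE pub-balaban NE9 CHAIN ARE BOUNDED BY FUNCTIONS OF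
# `(d, a, γ)` ALONE — `‖(QG₁Q†)⁻¹‖ ≤ Ξ(d,a)`, `‖H₁‖ ≤ √(Ξ(d,a)∕γ)`, `Ξ = 180d·1215²(27²∕4²)^{d−1} + 2a(1215∕12)²(27²∕6²)^{d−1}`: NO block size, NO lattice
# spacing, NO volume, NO operator bound of `Δ_a`** (the crude-constant corollary of `B9Eq3126KFloorFlat`)

statement-level skeleton of published theorems with citation tags; proofs where landed; nothing here is a claim about the Yang–Mills mass gap

CITATION HEADER (lean-in-tree rule).  Audit cell `pub-balaban`, sub-cell `t4`, BINDER row NE9; filed by NE9 formalisation-swarm LEAF PROVER 02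
(`b2b-balaban-t4-ne9-formalise-leaf-02`, gen 65).  Sources as `B9Eq3126KFloorFlat` (this lineage): [Balaban1985BackgroundPropagators] pp. 393–395, 416, 420;
[Balaban1985Variational] p. 285; [Balaban1985Averaging] p. 36.

THE PRINT (verbatim).  [B11] p. 285: *«… the Theorem 3.12 from [5] implies |HB| ≤ B₀(L^jη)^{−1}|B|, |∇HB| ≤ B₀(L^jη)^{−2}|B| on Ω_j. (46)»* with `B₀` independent of
the lattice; [B9] p. 416, Thm 3.11: *«the operators Δ′_a, G′, (Q′G′²Q′*)⁻¹, Δ_a, G are positive definite»*; p. 420, (3.126): *«HB = GQ*(QGQ*)⁻¹B»*.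

WHY THIS FILE (cell context).  `B9Eq3126KFloorFlat.norm_KinvLatticeK_H1LatticeK_one_le` bounds the two letters by `M_u∕(A−B)²` (and `√(·∕γ)`) with the bond
tent's explicit margin `A − B` and energy `M_u`; this file does the arithmetic at print's point: with `ηL = 1` (`‖η⁻¹‖ = L`) and canonical weights
`c₀L^d = c₁` every power of `L` cancels (`(A−B)² ≥ L^{4d+2}∕(1215·27^{d−1})²`, `M_u ≤ 180d·L^{4d+2}∕16^{d−1} + 2a·L^{4d+2}∕(12·6^{d−1})²`), leaving
`Ξ(d, a)` (the identity behind it is `ident`, stated with the three numerals `4, 6, 27` as letters so that `ring` sees one atom each).  So the `|η|⁻⁴ = L^{4(n+1)}` of the chain's `C_H`, `C_K` (operator currency) is an artefact of the currency, not of the letters — the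
`H`-analogue of the OWNER's TOWER-R-PROGRAMME conclusion for `C_R`.  The `k`-level port (flat tower = one step at block `L^{n+1}`, the OWNER's
`QkW_one_eq_oneStep`; `γ` from INTENT-8∕-9) and the windowed background are sequels.

WHAT IS PROVED (sorry-free; 0 `def`; [folklore] real arithmetic on the previous file's bound; nothing of [B9]∕[B11] asserted).
* `tent_ratio_le_diagonal` — the arithmetic: `ηL = 1`, `c₀L^d = c₁`, margin floor and size ceiling of the tent ⇒ energy∕margin² `≤ Ξ(d,a)` (block size cancels;
  `ident` with the numerals `4, 6, 27` as letters).
* **`norm_KinvLatticeK_H1LatticeK_one_le_diagonal`** — for `3 ≤ L`, `1 ≤ d`, `ηL = 1`, `c₀L^d = c₁`, `a > 0`, a displayed coercivity constant `γ` of `Δ_a(1)`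
  and ANY `hpos`, `hQ`: `‖KinvLatticeK hpos hQ y‖ ≤ Ξ(d,a)·‖y‖` and `‖H1LatticeK hpos hQ b‖ ≤ √(Ξ(d,a)∕γ)·‖b‖`.
HONEST SCOPE.  Crude constants (no attempt at the optimal bump); flat background, one step; `γ` displayed; NOT print's kernel bound (46) ∕ [B9] Thm 3.12 (decay),
only the `L²`-operator shadow; NOT NE9, NOT the route (cell pub-balaban: NE9 NOT PRINTED ∕ NOT PROVED; «NE9 ⇐ the named binders»; row WALLED ON A MODEL (O-NE9-1;
#5 UNRULED); spine PROVED 0∕9; rung (B)+1 on a finite T⁴ — NOT infinite volume, NOT mass gap, NOT BetaPertH, NOT Clay).  HONEST DEPENDENCY (cell line): continuum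
YM on T⁴ ⇐ BetaPertH ∧ nine spine estimates (0/9 proved); BetaPertH ⇐ (D1) ∧ (D4) ∧ CAP+tail; G-an2-4 gates asym, D1 and NE2/3/4.  NEW file importing
`B9Eq3126KFloorFlat` only; nothing modified.  Net new unproved facts: 0.
-/

noncomputable section

open scoped InnerProductSpace ComplexConjugate BigOperators

namespace Literature.MathematicalPhysics.QuantumFieldTheory.Balaban1983to89.B9Eq3126KFloorDiagonal

open B4Sect5Torus (TSite)
open B9SectCLatticeCarrier (Bond)
open B9Eq311L2Pairing (WL2)
open B9Eq319QprimeTorus (fineP)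
open B9Eq315QTorus (perCfg cornerSite QtorusW laplaceAofBackground)
open B7Prop1Explicit (U1 Wcx boxVec)
open B11Eq103H1Complex (BondL2K H1LatticeK KinvLatticeK)

variable {d : ℕ} (L : ℕ) [NeZero L] (m : Fin d → ℕ) [∀ i, NeZero (fineP L m i)]
  {𝔸 : Type*} [NormedRing 𝔸] [NormedAlgebra ℂ 𝔸] [CompleteSpace 𝔸] [NormOneClass 𝔸] [StarRing 𝔸] [StarModule ℂ 𝔸] (hL : 1 ≤ L)
  {α' : ℝ} (hα1' : α' ≤ 1 / 64)
  (hU1' : ∀ (x : B7Prop1Explicit.Site d) (κ : Fin d), perCfg (fineP L m) (fun _ : Bond d (fineP L m) => (1 : 𝔸ˣ)) x κ ∈ U1 𝔸)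
  (hreg' : ∀ (y : TSite d m) (κ : Fin d) (r : Fin d → Fin L),
    ‖((Wcx L (perCfg (fineP L m) (fun _ : Bond d (fineP L m) => (1 : 𝔸ˣ))) (cornerSite L y) κ (boxVec L r) : 𝔸ˣ) : 𝔸) - 1‖ ≤ α')
  {W : Type*} [NormedAddCommGroup W] [InnerProductSpace ℂ W] [FiniteDimensional ℂ W] (φ : W ≃ₗ[ℂ] 𝔸)
  {c₀ c₁ : ℝ} [Fact (0 < c₀)] [Fact (0 < c₁)] (τ : 𝔸 →ₗ[ℂ] ℂ) (η : ℝ)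

/-- the cancellation of the block size at print's point, with the numerals `4, 6, 27` as letters (one `ring` atom each) (private helper). [folklore] -/
private theorem ident (L A4 A6 A27 a : ℝ) (n : ℕ) (hL : L ≠ 0) (h4 : A4 ≠ 0) (h6 : A6 ≠ 0) (h27 : A27 ≠ 0) :
    L ^ 2 * (6 * L ^ 2 * (L ^ 2 / A4) ^ n) ^ 2 * (5 * ((n + 1 : ℕ) : ℝ)) +
        a * (2 * ((L ^ (n + 1 + 1))⁻¹ * ((L ^ 3 / A6) ^ n * (L * (L ^ 4 / 12)))) ^ 2) =
      (180 * ((n + 1 : ℕ) : ℝ) * 1215 ^ 2 * (A27 ^ 2 / A4 ^ 2) ^ n + 2 * a * (1215 / 12) ^ 2 * (A27 ^ 2 / A6 ^ 2) ^ n) *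
        ((L ^ (n + 1 + 1))⁻¹ * ((L ^ 3 / A27) ^ n * (L ^ 5 / 1215))) ^ 2 := by
  -- bring every symbolic power to the atoms `L^n`, `A4^n`, `A6^n`, `A27^n`, then clear denominators
  simp only [div_pow]
  rw [pow_right_comm A27 2 n, pow_right_comm A4 2 n, pow_right_comm A6 2 n, pow_right_comm L 3 n, pow_right_comm L 2 n,
    show L ^ (n + 1 + 1) = L ^ n * L ^ 2 by ring]
  have hLn : L ^ n ≠ 0 := pow_ne_zero _ hL
  have h4n : A4 ^ n ≠ 0 := pow_ne_zero _ h4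
  have h6n : A6 ^ n ≠ 0 := pow_ne_zero _ h6
  have h27n : A27 ^ n ≠ 0 := pow_ne_zero _ h27
  generalize L ^ n = pL at hLn ⊢
  generalize A4 ^ n = p4 at h4n ⊢
  generalize A6 ^ n = p6 at h6n ⊢
  generalize A27 ^ n = p27 at h27n ⊢
  field_simp
  ring

omit [NeZero L] [Fact (0 < c₀)] in
/-- **THE ARITHMETIC AT PRINT's POINT**: with `ηL = 1`, `c₀L^d = c₁`, for any two numbers `A ≥ B ≥ 0` with the tent's margin floor
`L^{−(d+1)}(L³∕27)^{d−1}L⁵∕1215 ≤ A − B` and size ceiling `A + B ≤ L^{−(d+1)}(L³∕6)^{d−1}·L·L⁴∕12`, the energy-over-squared-margin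
`(‖η⁻¹‖²(6L²(L²∕4)^{d−1})²·5d·(c₀L^d∕c₁) + 2a(A²+B²))∕(A−B)² ≤ Ξ(d,a)` — every power of the block size cancels (reusable by the k-level port, where
`A, B` are the same one-step numbers at block `L^{n+1}`). [folklore]
[cite: Balaban1985BackgroundPropagators, Thm 3.11 p.416, (3.126) p.420; Balaban1985Variational, (46) p.285] -/
theorem tent_ratio_le_diagonal (hL3 : 3 ≤ L) (hd : 1 ≤ d) (hη : η * L = 1) (hw : c₀ * (L : ℝ) ^ d = c₁) {a : ℝ} (ha : 0 ≤ a) {A B : ℝ} (hB : 0 ≤ B)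
    (hAB : ((L : ℝ) ^ (d + 1))⁻¹ * (((L : ℝ) ^ 3 / 27) ^ (d - 1) * ((L : ℝ) ^ 5 / 1215)) ≤ A - B)
    (hS : A + B ≤ ((L : ℝ) ^ (d + 1))⁻¹ * (((L : ℝ) ^ 3 / 6) ^ (d - 1) * ((L : ℝ) * ((L : ℝ) ^ 4 / 12)))) :
    (‖((η : ℂ))⁻¹‖ ^ 2 * (6 * (L : ℝ) ^ 2 * ((L : ℝ) ^ 2 / 4) ^ (d - 1)) ^ 2 * (5 * (d : ℝ)) * (c₀ * (L : ℝ) ^ d / c₁) + a * (2 * (A ^ 2 + B ^ 2))) /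
        (A - B) ^ 2 ≤ (180 * (d : ℝ) * 1215 ^ 2 * ((27 : ℝ) ^ 2 / 4 ^ 2) ^ (d - 1) + 2 * a * (1215 / 12) ^ 2 * ((27 : ℝ) ^ 2 / 6 ^ 2) ^ (d - 1)) := by
  have hc₁ : 0 < c₁ := Fact.out
  have hL0 : (0 : ℝ) < L := by exact_mod_cast (by omega : 0 < L)
  obtain ⟨n, rfl⟩ : ∃ n, d = n + 1 := ⟨d - 1, by omega⟩
  simp only [Nat.add_sub_cancel] at hAB hS ⊢
  -- the two substitutions of the diagonal
  have hηL : ‖((η : ℂ))⁻¹‖ ^ 2 = (L : ℝ) ^ 2 := by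
    have hη' : η = ((L : ℝ))⁻¹ := by field_simp; linarith
    rw [norm_inv, Complex.norm_real, Real.norm_eq_abs, hη', abs_of_pos (inv_pos.2 hL0), inv_inv]
  have hw' : c₀ * (L : ℝ) ^ (n + 1) / c₁ = 1 := by rw [hw, div_self hc₁.ne']
  rw [hηL, hw', mul_one]
  -- names for the two crude letters
  set β₀ : ℝ := ((L : ℝ) ^ (n + 1 + 1))⁻¹ * (((L : ℝ) ^ 3 / 27) ^ n * ((L : ℝ) ^ 5 / 1215)) with hβ₀
  set S : ℝ := ((L : ℝ) ^ (n + 1 + 1))⁻¹ * (((L : ℝ) ^ 3 / 6) ^ n * ((L : ℝ) * ((L : ℝ) ^ 4 / 12))) with hSd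
  have hβ₀pos : 0 < β₀ := by positivity
  have hABpos : 0 < A - B := lt_of_lt_of_le hβ₀pos hAB
  have hA0 : 0 ≤ A := by linarith
  have hsq : A ^ 2 + B ^ 2 ≤ S ^ 2 := by nlinarith [mul_nonneg hA0 hB]
  set M₁ : ℝ := (L : ℝ) ^ 2 * (6 * (L : ℝ) ^ 2 * ((L : ℝ) ^ 2 / 4) ^ n) ^ 2 * (5 * ((n + 1 : ℕ) : ℝ)) + a * (2 * S ^ 2) with hM₁
  have hMle : (L : ℝ) ^ 2 * (6 * (L : ℝ) ^ 2 * ((L : ℝ) ^ 2 / 4) ^ n) ^ 2 * (5 * ((n + 1 : ℕ) : ℝ)) + a * (2 * (A ^ 2 + B ^ 2)) ≤ M₁ := by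
    rw [hM₁]; nlinarith
  have hM₁0 : 0 ≤ M₁ := by positivity
  -- the identity at print's point: every power of `L` cancels
  have hid : M₁ = (180 * ((n + 1 : ℕ) : ℝ) * 1215 ^ 2 * ((27 : ℝ) ^ 2 / 4 ^ 2) ^ n + 2 * a * (1215 / 12) ^ 2 * ((27 : ℝ) ^ 2 / 6 ^ 2) ^ n) * β₀ ^ 2 := by
    rw [hM₁, hSd, hβ₀]
    exact ident (L : ℝ) 4 6 27 a n hL0.ne' (by norm_num) (by norm_num) (by norm_num)
  calc ((L : ℝ) ^ 2 * (6 * (L : ℝ) ^ 2 * ((L : ℝ) ^ 2 / 4) ^ n) ^ 2 * (5 * ((n + 1 : ℕ) : ℝ)) + a * (2 * (A ^ 2 + B ^ 2))) / (A - B) ^ 2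
      ≤ M₁ / (A - B) ^ 2 := div_le_div_of_nonneg_right hMle (sq_nonneg _)
    _ ≤ M₁ / β₀ ^ 2 := div_le_div_of_nonneg_left hM₁0 (by positivity) (pow_le_pow_left₀ hβ₀pos.le hAB 2)
    _ = 180 * ((n + 1 : ℕ) : ℝ) * 1215 ^ 2 * ((27 : ℝ) ^ 2 / 4 ^ 2) ^ n + 2 * a * (1215 / 12) ^ 2 * ((27 : ℝ) ^ 2 / 6 ^ 2) ^ n := by
        rw [hid, mul_div_assoc, div_self (pow_ne_zero 2 hβ₀pos.ne'), mul_one]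

omit [NeZero L] in
/-- **THE THREE NUMBERS OF THE BOND TENT**: `0 ≤ B`, the margin floor `L^{−(d+1)}(L³∕27)^{d−1}L⁵∕1215 ≤ A − B` (`3 ≤ L`) and the size ceiling
`A + B ≤ L^{−(d+1)}(L³∕6)^{d−1}·L·L⁴∕12` (sweep counts + `B9Eq3126BondTentProfile`). [folklore]
[cite: Balaban1985Averaging, (125) p.36; Balaban1985BackgroundPropagators, Thm 3.11 p.416] -/
theorem tent_numbers_bounds (hL3 : 3 ≤ L) :
    0 ≤ (((L : ℝ) ^ (d + 1))⁻¹ * ((∑ k ∈ Finset.range L, (k : ℝ) * ((L : ℝ) - 1 - k)) ^ (d - 1) *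
          ∑ k ∈ Finset.range L, ∑ t ∈ Finset.range k, (t : ℝ) ^ 2 * ((L : ℝ) - 1 - t))) ∧
    ((L : ℝ) ^ (d + 1))⁻¹ * (((L : ℝ) ^ 3 / 27) ^ (d - 1) * ((L : ℝ) ^ 5 / 1215)) ≤
      (((L : ℝ) ^ (d + 1))⁻¹ * ((∑ k ∈ Finset.range L, (k : ℝ) * ((L : ℝ) - 1 - k)) ^ (d - 1) *
          ∑ k ∈ Finset.range L, ∑ i ∈ Finset.range (L - k), ((k + i : ℕ) : ℝ) ^ 2 * ((L : ℝ) - 1 - ((k + i : ℕ) : ℝ)))) -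
      (((L : ℝ) ^ (d + 1))⁻¹ * ((∑ k ∈ Finset.range L, (k : ℝ) * ((L : ℝ) - 1 - k)) ^ (d - 1) *
          ∑ k ∈ Finset.range L, ∑ t ∈ Finset.range k, (t : ℝ) ^ 2 * ((L : ℝ) - 1 - t))) ∧
    (((L : ℝ) ^ (d + 1))⁻¹ * ((∑ k ∈ Finset.range L, (k : ℝ) * ((L : ℝ) - 1 - k)) ^ (d - 1) *
          ∑ k ∈ Finset.range L, ∑ i ∈ Finset.range (L - k), ((k + i : ℕ) : ℝ) ^ 2 * ((L : ℝ) - 1 - ((k + i : ℕ) : ℝ)))) +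
      (((L : ℝ) ^ (d + 1))⁻¹ * ((∑ k ∈ Finset.range L, (k : ℝ) * ((L : ℝ) - 1 - k)) ^ (d - 1) *
          ∑ k ∈ Finset.range L, ∑ t ∈ Finset.range k, (t : ℝ) ^ 2 * ((L : ℝ) - 1 - t))) ≤ ((L : ℝ) ^ (d + 1))⁻¹ * (((L : ℝ) ^ 3 / 6) ^ (d - 1) * ((L : ℝ) * ((L : ℝ) ^ 4 / 12))) := by
  have hAB := B9Eq3126KFloorFlat.tent_margin_ge (d := d) L hL3
  have hP0 : 0 ≤ ∑ k ∈ Finset.range L, (k : ℝ) * ((L : ℝ) - 1 - k) :=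
    Finset.sum_nonneg fun k hk => B9Eq319BlockTentLift.profile_nonneg (Finset.mem_range.1 hk)
  have hPle := B9Eq3126BondTentProfile.sum_profile_le L
  have hSA := B9Eq3126BondTentProfile.sum_sum_range_sub_eq (fun t : ℕ => (t : ℝ) ^ 2 * ((L : ℝ) - 1 - t)) L
  have hSB := B9Eq3126BondTentProfile.sum_sum_range_lt_eq (fun t : ℕ => (t : ℝ) ^ 2 * ((L : ℝ) - 1 - t)) L
  have hsum := B9Eq3126BondTentProfile.sum_succ_mul_qprof_add L (fun t : ℕ => (t : ℝ) ^ 2 * ((L : ℝ) - 1 - t))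
  have hS0 := B9Eq3126BondTentProfile.sum_qprof_le (L := L) (by omega)
  have hSB0 : 0 ≤ ∑ k ∈ Finset.range L, ∑ t ∈ Finset.range k, (t : ℝ) ^ 2 * ((L : ℝ) - 1 - t) :=
    Finset.sum_nonneg fun k hk => Finset.sum_nonneg fun t ht =>
      B9Eq3126BondTentProfile.qprof_nonneg (lt_trans (Finset.mem_range.1 ht) (Finset.mem_range.1 hk))
  have hL0 : (0 : ℝ) < L := by exact_mod_cast (by omega : 0 < L)
  refine ⟨by positivity, hAB, ?_⟩
  rw [← mul_add, ← mul_add, hSA, hSB, hsum]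
  refine mul_le_mul_of_nonneg_left ?_ (by positivity)
  exact mul_le_mul (pow_le_pow_left₀ hP0 hPle _) (mul_le_mul_of_nonneg_left hS0 hL0.le)
    (mul_nonneg hL0.le (Finset.sum_nonneg fun k hk => B9Eq3126BondTentProfile.qprof_nonneg (Finset.mem_range.1 hk))) (by positivity)

/-- **ON THE DIAGONAL `ηL = 1`, `c₀L^d = c₁`: `‖(Q(1)G₁(1)Q(1)†)⁻¹‖ ≤ Ξ(d,a)` AND `‖H₁(1)‖ ≤ √(Ξ(d,a)∕γ)`, `Ξ = 180d·1215²(27²∕4²)^{d−1} + 2a(1215∕12)²(27²∕6²)^{d−1}`**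
— for `3 ≤ L`, `1 ≤ d`, `a > 0`, a displayed coercivity constant `γ` of `Δ_a(1)` and ANY witnesses `hpos`, `hQ`; no block size, lattice spacing, volume or operator
bound of `Δ_a` in the constants (`B9Eq3126KFloorFlat.norm_KinvLatticeK_H1LatticeK_one_le` + the margin∕size letters of the bond tent + arithmetic). [folklore]
[cite: Balaban1985BackgroundPropagators, (3.126) p.420, Thm 3.11 p.416, (3.26) p.395; Balaban1985Variational, (45)–(46) p.285] -/
theorem norm_KinvLatticeK_H1LatticeK_one_le_diagonal (hL3 : 3 ≤ L) (hd : 1 ≤ d) (hη : η * L = 1) (hw : c₀ * (L : ℝ) ^ d = c₁)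
    {a : ℝ} (ha : 0 < a) {γ : ℝ} (hγ : 0 < γ)
    (hcoer : ∀ x : BondL2K ℂ d (fineP L m) c₀ W, γ * ‖x‖ ^ 2 ≤
      RCLike.re ⟪x, laplaceAofBackground L m hL φ (fun _ : Bond d (fineP L m) => (1 : 𝔸ˣ)) hα1' hU1' hreg' τ η (c₀ := c₀) (c₁ := c₁) a x⟫_ℂ)
    (hpos : ∀ x : BondL2K ℂ d (fineP L m) c₀ W, x ≠ 0 →
      0 < RCLike.re ⟪x, laplaceAofBackground L m hL φ (fun _ : Bond d (fineP L m) => (1 : 𝔸ˣ)) hα1' hU1' hreg' τ η (c₀ := c₀) (c₁ := c₁) a x⟫_ℂ)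
    (hQ : Function.Surjective (QtorusW L m hL φ (fun _ : Bond d (fineP L m) => (1 : 𝔸ˣ)) hα1' hU1' hreg' (c₀ := c₀) (c₁ := c₁))) :
    (∀ y : BondL2K ℂ d m c₁ W, ‖KinvLatticeK hpos hQ y‖ ≤ (180 * (d : ℝ) * 1215 ^ 2 * ((27 : ℝ) ^ 2 / 4 ^ 2) ^ (d - 1) + 2 * a * (1215 / 12) ^ 2 * ((27 : ℝ) ^ 2 / 6 ^ 2) ^ (d - 1)) * ‖y‖) ∧
      ∀ b : BondL2K ℂ d m c₁ W, ‖H1LatticeK hpos hQ b‖ ≤ Real.sqrt ((180 * (d : ℝ) * 1215 ^ 2 * ((27 : ℝ) ^ 2 / 4 ^ 2) ^ (d - 1) + 2 * a * (1215 / 12) ^ 2 * ((27 : ℝ) ^ 2 / 6 ^ 2) ^ (d - 1)) / γ) * ‖b‖ := by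
  obtain ⟨hK, hH⟩ := B9Eq3126KFloorFlat.norm_KinvLatticeK_H1LatticeK_one_le L m hL hα1' hU1' hreg' φ τ η (c₀ := c₀) (c₁ := c₁) hL3 ha hγ hcoer hpos hQ
  obtain ⟨hB, hAB, hS⟩ := tent_numbers_bounds (d := d) L hL3
  have key := tent_ratio_le_diagonal (c₀ := c₀) (c₁ := c₁) L η hL3 hd hη hw ha.le hB hAB hS
  refine ⟨fun y => (hK y).trans (mul_le_mul_of_nonneg_right key (norm_nonneg _)), fun b => (hH b).trans ?_⟩
  refine mul_le_mul_of_nonneg_right (Real.sqrt_le_sqrt ?_) (norm_nonneg _)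
  rw [mul_comm γ, ← div_div]
  exact div_le_div_of_nonneg_right key hγ.le

end Literature.MathematicalPhysics.QuantumFieldTheory.Balaban1983to89.B9Eq3126KFloorDiagonal

end
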